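import Summits.QuantumFields.YangMills.Theorems.BalabanUVNodesN15CurvedGluingCubeDressedTwoSided
import HarnessLib

/-!
# Route «BalabanUVNodes» (cluster K4 «SpineRates»), Track-A DAG node N15 = NE2, BACKGROUND LAYER — THE SANDWICHED FLAT CUBE: `hloc` MODULO AN EXPONENTIALLY SMALL DEFECT, AND ITS DRESSING

Cell `pub-ymgap`, seat `pub-ymgap-dag-n15-w3` (WIDTH SEAT 3∕3 on node N15, director-ym №197 ∕ HUMAN RULING D-0149; plan `W-SEAT-START-LIST.md` §n15 item 3 — twenty-second piece: the
interface between dag-n15-a's flat cube objects and file 21's defect edition).  `bears_on: R4∕N15 · K3⁷ SpineGivenEndpointR13SepCoPH (stmt-QuantumFields-20544)`.  Filed `--kind proof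
--supports stmt-QuantumFields-20544 --as helper` — COUNT-NEUTRAL.  Theorems only; 0 `sorry`.  Imports BY NAME file 21 `…N15CurvedGluingCubeDressedTwoSided`
(`mulOp_comp_sub_speciesOpM_comp_dressed_of_defect`, `hasMaj_defect_comp`; file 20 `hasMaj_localize_out`; file 13 `covLapM_eq_lapOp`; dag-n15-c FILE 45∕46∕47∕51 `lapDir`∕`lapOp`∕
`hasMaj_mulOp_sandwich`∕`mulOp_comp_mulOp`∕`mulOp_add`; lit `hasMaj_comp_exp`); nothing in the tree is modified.

WHY.  A flat cube propagator comes in two dresses: UNSANDWICHED (`G`, e.g. dag-n15-a's images propagator `neumannCubeG`: it inverts `Δ` on the cube EXACTLY, `M_hΔG = M_h` for `h` inside —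
his ★★★ `mulOp_comp_deltaOp_comp_neumannCubeG` — but its outputs off the cube are mirror images, no global decay) and SANDWICHED (`M_χG`: global two-sided rows `1_□1_□βe^{−δd}` — his
`hasMaj_chiCube_neumannCubeG` — but `M_hΔM_χG = M_h − M_hΔM_{1−χ}G`).  Split `Δ = L + N`, `L` one-step local (`Σ∇*∇`, the species, `Δ_U`), `N` the rest (Bałaban's nonlocal Landau term
`−∂Π∂*`, [B5] (1.120)–(1.128)).  §1: `M_hLM_{1−χ} = 0` as soon as `h` and its one-step stencil sit inside `{χ = 1}` — EXACT lattice locality.  §2: hence `M_hΔ(M_χG) = M_h + E`,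
`E = −(M_hNM_{1−χ})G`.  §3: a sandwich `M_hTM_k` of a decaying kernel between supports at block distance `≥ R₀` gains `e^{−δ′R₀}`: `≤ 1_H(y)1_K(y′)·ce^{−δ′R₀}·e^{−(δ−δ′)d}`.  §4: so
`E ≤ 1_H(y)·c_Ne^{−δ′R₀}βc_r·e^{−ρd}` — exponentially small in the collar width — and file 21's defect edition dresses the sandwiched cube at a live background:
`M_h(Δ − V)X = M_h + E(1 + VX)`.

* §1 `mulOp_comp_fgrad_comp_mulOp_eq_zero`, `mulOp_comp_bgrad_comp_mulOp_eq_zero`, `mulOp_comp_lapDir_comp_mulOp_eq_zero` (generic carrier); `mulOp_fst_comm_mmulOp`,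
  ★ `mulOp_comp_speciesOpM_comp_mulOp_eq_zero`, ★ `mulOp_comp_lapOp_comp_mulOp`, ★ `mulOp_comp_covLapM_comp_mulOp_eq_zero` (product carrier);
* §2 `mulOp_eq_id_sub`, ★★ `mulOp_comp_comp_sandwich_of_hloc` (`M_hΔ(M_χG) = M_h + (−(M_hNM_{1−χ}))∘G`);
* §3 `hasMaj_localize₂` (two-set localization), ★★ `hasMaj_sandwich_separated`;
* §4 ★★ `hasMaj_sandwichDefect`, ★★★ `mulOp_comp_sub_speciesOpM_comp_dressed_sandwich` (by name through file 21).

HONEST FRAMING ∕ LIMITS.  Finite-dimensional algebra + block-majorant bookkeeping over DISPLAYED letters (`G`, `χ`, `h`, the split `Δ = L + N` and `N`'s decay `c_N, δ_N` — [B5] (1.126)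
is NOT proved here; the producers are dag-n15-a's N-programme); ONE grid; nothing of [B5]∕[B6]∕[B9] asserted ((1.120)–(1.128) pp. 37–38, (2.37)–(2.38) p. 229, (2.91) p. 239, (2.133)
p. 247, (3.62)–(3.65) pp. 402–403 = SHAPES ∕ MECHANISM).  NE2⁺ NOT PRINTED, NOT proved; N15 NOT discharged; counts of record UNMOVED (typed 28∕28 · discharged 5∕27); one finite 𝕋⁴ at
fixed ε — NOT infinite volume, NOT OS on ℝ⁴, NOT a mass gap, NOT Clay; R4 closes the conditional finite-𝕋⁴ rung `BalabanLadder.UV` only.  Restate-immune (no Theses import).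
-/

set_option autoImplicit false

noncomputable section
open scoped BigOperators
open Finset

namespace Summit.QuantumFields.YangMills.BalabanUVNodes.N15.CurvedSpecies

open Literature.MathematicalPhysics.QuantumFieldTheory.Balaban1983to89
open Literature.MathematicalPhysics.QuantumFieldTheory.Balaban1983to89.B11SectG (BlockNorm HasMaj RowSum hasMaj_comp_exp)
open Literature.MathematicalPhysics.QuantumFieldTheory.Balaban1983to89.B6RandomWalk (Triangle254)
open Literature.MathematicalPhysics.QuantumFieldTheory.Balaban1983to89.B6Prop26Gluing (mulOp mulOp_apply ind ind_nonneg ind_of_mem)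
open Summit.QuantumFields.YangMills.BalabanUVNodes.N15.MatrixSpecies (mmulOp mmulOp_apply liftBlk liftEquiv liftEquiv_apply liftEquiv_symm_apply)
open Summit.QuantumFields.YangMills.BalabanUVNodes.N15.BackgroundModel (kappa_ofBlocks)
open Summit.QuantumFields.YangMills.BalabanUVNodes.N15.BackgroundLayer (fgrad bgrad fgradAdj fgrad_apply bgrad_apply fgradAdj_apply speciesOpM stack projO bgPairM unstackM covLapM tCoefA
  tCoefC linearMap_sum_comp linearMap_comp_sum)
open Summit.QuantumFields.YangMills.BalabanUVNodes.N15.Gluing (lapDir lapOp loc_ofBlocks_eq_zero hasMaj_mulOp_sandwich sandwich_in_out)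

/-! ## §1 Exact lattice locality: one-step operators vanish between separated multipliers -/

section Locality

variable {Y : Type} (n : ℝ) (e : Y ≃ Y) {h k : Y → ℝ}

/-- `M_h∘∇⁺∘M_k = 0` when `h·k = 0` and `h·(k∘e) = 0` (the forward quotient's stencil `{p, ep}`). [folklore; cite: Balaban1984PropagatorsII, (2.38) p.229 (locality: mechanism)] -/
theorem mulOp_comp_fgrad_comp_mulOp_eq_zero (h0 : ∀ p, h p * k p = 0) (h1 : ∀ p, h p * k (e p) = 0) : mulOp h ∘ₗ fgrad n e ∘ₗ mulOp k = 0 := by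
  refine LinearMap.ext fun f => funext fun p => ?_
  simp only [LinearMap.comp_apply, mulOp_apply, fgrad_apply, LinearMap.zero_apply, Pi.zero_apply]
  have key : h p * (n * (k (e p) * f (e p) - k p * f p)) = n * (h p * k (e p) * f (e p) - h p * k p * f p) := by ring
  rw [key, h0 p, h1 p, zero_mul, zero_mul, sub_zero, mul_zero]

/-- `M_h∘∇⁻∘M_k = 0` when `h·k = 0` and `h·(k∘e⁻¹) = 0`. [folklore] -/
theorem mulOp_comp_bgrad_comp_mulOp_eq_zero (h0 : ∀ p, h p * k p = 0) (h2 : ∀ p, h p * k (e.symm p) = 0) : mulOp h ∘ₗ bgrad n e ∘ₗ mulOp k = 0 := by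
  refine LinearMap.ext fun f => funext fun p => ?_
  simp only [LinearMap.comp_apply, mulOp_apply, bgrad_apply, LinearMap.zero_apply, Pi.zero_apply]
  have key : h p * (n * (k p * f p - k (e.symm p) * f (e.symm p))) = n * (h p * k p * f p - h p * k (e.symm p) * f (e.symm p)) := by ring
  rw [key, h0 p, h2 p, zero_mul, zero_mul, sub_zero, mul_zero]

/-- `M_h∘∇*∇∘M_k = 0` when `h·k = h·(k∘e) = h·(k∘e⁻¹) = 0` (the second difference's stencil `{e⁻¹p, p, ep}`). [folklore; cite: Balaban1984PropagatorsII, (2.38) p.229 (mechanism)] -/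
theorem mulOp_comp_lapDir_comp_mulOp_eq_zero (h0 : ∀ p, h p * k p = 0) (h1 : ∀ p, h p * k (e p) = 0) (h2 : ∀ p, h p * k (e.symm p) = 0) :
    mulOp h ∘ₗ lapDir n e ∘ₗ mulOp k = 0 := by
  refine LinearMap.ext fun f => funext fun p => ?_
  simp only [lapDir, LinearMap.comp_apply, mulOp_apply, fgradAdj_apply, fgrad_apply, Equiv.apply_symm_apply, LinearMap.zero_apply, Pi.zero_apply]
  have key : h p * (n * (n * (k p * f p - k (e.symm p) * f (e.symm p)) - n * (k (e p) * f (e p) - k p * f p))) =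
      n * n * (2 * (h p * k p) * f p - h p * k (e.symm p) * f (e.symm p) - h p * k (e p) * f (e p)) := by ring
  rw [key, h0 p, h1 p, h2 p]
  ring

end Locality

section LocalityProduct

variable {X ι J : Type} [Fintype X] [DecidableEq X] [Fintype ι] [DecidableEq ι] [Fintype J] [DecidableEq J] (τ : J → X ≃ X) (n : ℝ) (C : X → Matrix ι ι ℝ)
  (A : J ⊕ J → X → Matrix ι ι ℝ) {hX kX : X → ℝ}

omit [Fintype X] [DecidableEq X] [DecidableEq ι] [Fintype J] [DecidableEq J] in
/-- a site multiplier commutes with a fibre matrix multiplication. [folklore] -/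
theorem mulOp_fst_comm_mmulOp : mulOp (fun p : X × ι => hX p.1) ∘ₗ mmulOp C = mmulOp C ∘ₗ mulOp (fun p : X × ι => hX p.1) := by
  refine LinearMap.ext fun f => funext fun p => ?_
  simp only [LinearMap.comp_apply, mulOp_apply, mmulOp_apply, Finset.mul_sum]
  refine Finset.sum_congr rfl fun j _ => ?_
  ring

omit [Fintype X] [DecidableEq X] [Fintype ι] [DecidableEq ι] [Fintype J] [DecidableEq J] in
/-- the product of separated site multipliers vanishes. [folklore] -/
theorem mulOp_fst_comp_mulOp_fst_eq_zero (h0 : ∀ x, hX x * kX x = 0) : mulOp (fun p : X × ι => hX p.1) ∘ₗ mulOp (fun p : X × ι => kX p.1) = 0 := by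
  refine LinearMap.ext fun f => funext fun p => ?_
  simp only [LinearMap.comp_apply, mulOp_apply, LinearMap.zero_apply, Pi.zero_apply, ← mul_assoc, h0 p.1, zero_mul]

omit [Fintype X] [DecidableEq X] [DecidableEq ι] [DecidableEq J] in
/-- ★ **THE SPECIES IS ONE-STEP LOCAL**: `M_h∘V(c, a)∘M_k = 0` when `h(x)k(x) = h(x)k(τ_μx) = h(x)k(τ_μ⁻¹x) = 0`. [cite: Balaban1985BackgroundPropagators, (3.52) p.400 (a first-order difference operator: shape)] -/
theorem mulOp_comp_speciesOpM_comp_mulOp_eq_zero (h0 : ∀ x, hX x * kX x = 0) (h1 : ∀ μ x, hX x * kX (τ μ x) = 0) (h2 : ∀ μ x, hX x * kX ((τ μ).symm x) = 0) :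
    mulOp (fun p : X × ι => hX p.1) ∘ₗ speciesOpM τ n C A ∘ₗ mulOp (fun p : X × ι => kX p.1) = 0 := by
  have hf : ∀ μ, mulOp (fun p : X × ι => hX p.1) ∘ₗ fgrad n (liftEquiv (τ μ) ι) ∘ₗ mulOp (fun p : X × ι => kX p.1) = 0 := fun μ =>
    mulOp_comp_fgrad_comp_mulOp_eq_zero n _ (fun p => h0 p.1) fun p => by rw [liftEquiv_apply]; exact h1 μ p.1
  have hb : ∀ μ, mulOp (fun p : X × ι => hX p.1) ∘ₗ bgrad n (liftEquiv (τ μ) ι) ∘ₗ mulOp (fun p : X × ι => kX p.1) = 0 := fun μ =>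
    mulOp_comp_bgrad_comp_mulOp_eq_zero n _ (fun p => h0 p.1) fun p => by rw [liftEquiv_symm_apply]; exact h2 μ p.1
  have h00 := mulOp_fst_comp_mulOp_fst_eq_zero (ι := ι) h0
  have haux : ∀ (B : X → Matrix ι ι ℝ) (Dop : (X × ι → ℝ) →ₗ[ℝ] (X × ι → ℝ)),
      mulOp (fun p : X × ι => hX p.1) ∘ₗ Dop ∘ₗ mulOp (fun p : X × ι => kX p.1) = 0 →
        mulOp (fun p : X × ι => hX p.1) ∘ₗ (mmulOp B ∘ₗ Dop) ∘ₗ mulOp (fun p : X × ι => kX p.1) = 0 := fun B Dop hD => by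
    rw [show mulOp (fun p : X × ι => hX p.1) ∘ₗ (mmulOp B ∘ₗ Dop) ∘ₗ mulOp (fun p : X × ι => kX p.1) =
        (mulOp (fun p : X × ι => hX p.1) ∘ₗ mmulOp B) ∘ₗ (Dop ∘ₗ mulOp (fun p : X × ι => kX p.1)) by simp only [LinearMap.comp_assoc],
      mulOp_fst_comm_mmulOp, LinearMap.comp_assoc, hD, LinearMap.comp_zero]
  have hC0 : mulOp (fun p : X × ι => hX p.1) ∘ₗ mmulOp C ∘ₗ mulOp (fun p : X × ι => kX p.1) = 0 := by
    rw [← LinearMap.comp_assoc, mulOp_fst_comm_mmulOp, LinearMap.comp_assoc, h00, LinearMap.comp_zero]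
  rw [speciesOpM, LinearMap.add_comp, LinearMap.comp_add, linearMap_sum_comp, linearMap_comp_sum, hC0, zero_add]
  refine Finset.sum_eq_zero fun μ _ => ?_
  rw [LinearMap.add_comp, LinearMap.comp_add, haux _ _ (hf μ), haux _ _ (hb μ), add_zero]

omit [Fintype X] [DecidableEq X] [Fintype ι] [DecidableEq ι] [DecidableEq J] in
/-- ★ a Laplacian-type operator sandwiched between separated multipliers reduces to its zero-order∕nonlocal part: `M_h∘(Σ_μ∇*_μ∇_μ + W)∘M_k = M_h∘W∘M_k`.
[cite: Balaban1985BackgroundPropagators, (3.26) p.395 (shape); Balaban1984PropagatorsII, (2.38) p.229 (mechanism)] -/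
theorem mulOp_comp_lapOp_comp_mulOp (W : (X × ι → ℝ) →ₗ[ℝ] (X × ι → ℝ)) (h0 : ∀ x, hX x * kX x = 0) (h1 : ∀ μ x, hX x * kX (τ μ x) = 0)
    (h2 : ∀ μ x, hX x * kX ((τ μ).symm x) = 0) :
    mulOp (fun p : X × ι => hX p.1) ∘ₗ lapOp n (fun μ => liftEquiv (τ μ) ι) W ∘ₗ mulOp (fun p : X × ι => kX p.1) =
      mulOp (fun p : X × ι => hX p.1) ∘ₗ W ∘ₗ mulOp (fun p : X × ι => kX p.1) := by
  have hl : ∀ μ, mulOp (fun p : X × ι => hX p.1) ∘ₗ lapDir n (liftEquiv (τ μ) ι) ∘ₗ mulOp (fun p : X × ι => kX p.1) = 0 := fun μ =>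
    mulOp_comp_lapDir_comp_mulOp_eq_zero n _ (fun p => h0 p.1) (fun p => by rw [liftEquiv_apply]; exact h1 μ p.1) fun p => by
      rw [liftEquiv_symm_apply]; exact h2 μ p.1
  rw [lapOp, LinearMap.add_comp, LinearMap.comp_add, linearMap_sum_comp, linearMap_comp_sum, Finset.sum_eq_zero fun μ _ => hl μ, zero_add]

omit [Fintype X] [DecidableEq X] [DecidableEq J] in
/-- ★ **BAŁABAN's COVARIANT LAPLACIAN IS ONE-STEP LOCAL**: `M_h∘Δ_U∘M_k = 0` under the same separation (file 13 `covLapM_eq_lapOp` + the species' locality).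
[cite: Balaban1985BackgroundPropagators, (3.6) p.389, (3.53) p.400 (shapes)] -/
theorem mulOp_comp_covLapM_comp_mulOp_eq_zero (η : ℝ) (U : J ⊕ J → X → Matrix ι ι ℝ) (h0 : ∀ x, hX x * kX x = 0) (h1 : ∀ μ x, hX x * kX (τ μ x) = 0)
    (h2 : ∀ μ x, hX x * kX ((τ μ).symm x) = 0) : mulOp (fun p : X × ι => hX p.1) ∘ₗ covLapM τ η U ∘ₗ mulOp (fun p : X × ι => kX p.1) = 0 := by
  rw [covLapM_eq_lapOp, mulOp_comp_lapOp_comp_mulOp τ η⁻¹ _ h0 h1 h2, LinearMap.neg_comp, LinearMap.comp_neg, mulOp_comp_speciesOpM_comp_mulOp_eq_zero τ η⁻¹ _ _ h0 h1 h2, neg_zero]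

end LocalityProduct

/-! ## §2 The sandwich defect: `M_hΔ(M_χG) = M_h − (M_hNM_{1−χ})G` -/

section Sandwich

variable {Y : Type} {Δ L N G : (Y → ℝ) →ₗ[ℝ] (Y → ℝ)} {h χ : Y → ℝ}

/-- `M_χ = 1 − M_{1−χ}`. [folklore] -/
theorem mulOp_eq_id_sub (χ : Y → ℝ) : mulOp χ = LinearMap.id - mulOp (1 - χ) := by
  refine LinearMap.ext fun f => funext fun p => ?_
  simp only [mulOp_apply, LinearMap.sub_apply, LinearMap.id_apply, Pi.sub_apply, Pi.one_apply]
  ring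

/-- ★★ **`hloc` OF THE SANDWICHED CUBE, MODULO THE NONLOCAL TAIL**: if the unsandwiched cube inverts `Δ` against `h` exactly (`M_hΔG = M_h`), `Δ = L + N` and the local part cannot
cross the collar (`M_hLM_{1−χ} = 0`), then `M_hΔ(M_χG) = M_h + (−(M_hNM_{1−χ}))∘G`. [cite: Balaban1984PropagatorsII, (2.37)–(2.38) p.229, (2.91) p.239 (mechanism); Balaban1984PropagatorsI, (1.120)–(1.121) p.37 (the nonlocal `P(dh)`: shape)] -/
theorem mulOp_comp_comp_sandwich_of_hloc (hloc0 : mulOp h ∘ₗ Δ ∘ₗ G = mulOp h) (hΔ : Δ = L + N) (hL : mulOp h ∘ₗ L ∘ₗ mulOp (1 - χ) = 0) :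
    mulOp h ∘ₗ Δ ∘ₗ (mulOp χ ∘ₗ G) = mulOp h + (-(mulOp h ∘ₗ N ∘ₗ mulOp (1 - χ))) ∘ₗ G := by
  have hsplit : mulOp h ∘ₗ Δ ∘ₗ mulOp (1 - χ) = mulOp h ∘ₗ N ∘ₗ mulOp (1 - χ) := by
    rw [hΔ, LinearMap.add_comp, LinearMap.comp_add, hL, zero_add]
  have h1 : mulOp h ∘ₗ Δ ∘ₗ (mulOp χ ∘ₗ G) = mulOp h ∘ₗ Δ ∘ₗ G - (mulOp h ∘ₗ Δ ∘ₗ mulOp (1 - χ)) ∘ₗ G := by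
    rw [mulOp_eq_id_sub χ, LinearMap.sub_comp, LinearMap.id_comp, LinearMap.comp_sub, LinearMap.comp_sub]
    simp only [LinearMap.comp_assoc]
  rw [h1, hloc0, hsplit, LinearMap.neg_comp, sub_eq_add_neg]

end Sandwich

/-! ## §3 Separated sandwiches of a decaying kernel gain `e^{−δ′R₀}` -/

section Separated

variable {X₁ X₂ : Type} [Fintype X₁] [Fintype X₂] {g : B6.Geometry} (blk₁ : X₁ → g.Site) (blk₂ : X₂ → g.Site)

/-- TWO-SET LOCALIZATION: outputs vanishing off `H` and inputs read only over `K` improve `K₀ ≥ 0` to `1_H(y)1_K(y′)·K₀`. [cite: Balaban1984PropagatorsII, (2.133) p.247 (shape)] -/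
theorem hasMaj_localize₂ {R : (X₁ → ℝ) →ₗ[ℝ] (X₂ → ℝ)} {H K : Set g.Site} {K₀ : g.Site → g.Site → ℝ} (hK : ∀ a b, 0 ≤ K₀ a b) (hout : ∀ μ x, blk₂ x ∉ H → R μ x = 0)
    (hin : ∀ μ : X₁ → ℝ, (∀ x, blk₁ x ∈ K → μ x = 0) → R μ = 0) (hR : HasMaj (BlockNorm.ofBlocks g blk₁) (BlockNorm.ofBlocks g blk₂) R K₀) :
    HasMaj (BlockNorm.ofBlocks g blk₁) (BlockNorm.ofBlocks g blk₂) R (fun y y' => ind H y * ind K y' * K₀ y y') := by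
  intro y' μ hμ y
  dsimp only
  have hμ' : ∀ x, blk₁ x ≠ y' → μ x = 0 := hμ
  by_cases hy' : y' ∈ K
  · by_cases hy : y ∈ H
    · rw [ind_of_mem hy, ind_of_mem hy', one_mul, one_mul]
      exact hR y' μ hμ y
    · rw [loc_ofBlocks_eq_zero blk₂ fun x hx => hout μ x (hx ▸ hy)]
      exact mul_nonneg (mul_nonneg (mul_nonneg (ind_nonneg _ _) (ind_nonneg _ _)) (hK _ _)) ((BlockNorm.ofBlocks g blk₁).loc_nonneg y' μ)
  · have hR0 : R μ = 0 := hin μ fun x hx => hμ' x fun h => hy' (h ▸ hx)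
    rw [hR0, (BlockNorm.ofBlocks g blk₂).loc_zero]
    exact mul_nonneg (mul_nonneg (mul_nonneg (ind_nonneg _ _) (ind_nonneg _ _)) (hK _ _)) ((BlockNorm.ofBlocks g blk₁).loc_nonneg y' μ)

variable {X : Type} [Fintype X] (blk : X → g.Site)

/-- ★★ **SEPARATED SANDWICHES GAIN `e^{−δ′R₀}`**: `T ≤ ce^{−δd}`, `|h|, |k| ≤ 1`, `supp h` over `H`, `supp k` over `K`, `d(y, y′) ≥ R₀` for `y ∈ H`, `y′ ∈ K`, `0 ≤ δ′` ⟹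
`M_hTM_k ≤ 1_H(y)1_K(y′)·ce^{−δ′R₀}·e^{−(δ−δ′)d}`. [cite: Balaban1984PropagatorsI, (1.126)–(1.128) p.38 («a small factor … and the exponential factor»: mechanism)] -/
theorem hasMaj_sandwich_separated {T : (X → ℝ) →ₗ[ℝ] (X → ℝ)} {h k : X → ℝ} {H K : Set g.Site} {c δ δ' R₀ : ℝ} (hc : 0 ≤ c) (hδ' : 0 ≤ δ') (hh : ∀ x, |h x| ≤ 1) (hk : ∀ x, |k x| ≤ 1)
    (hH : ∀ x, h x ≠ 0 → blk x ∈ H) (hKs : ∀ x, k x ≠ 0 → blk x ∈ K) (hsep : ∀ y ∈ H, ∀ y' ∈ K, R₀ ≤ g.dist y y')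
    (hT : HasMaj (BlockNorm.ofBlocks g blk) (BlockNorm.ofBlocks g blk) T (fun y y' => c * Real.exp (-(δ * g.dist y y')))) :
    HasMaj (BlockNorm.ofBlocks g blk) (BlockNorm.ofBlocks g blk) (mulOp h ∘ₗ T ∘ₗ mulOp k)
      (fun y y' => ind H y * ind K y' * (c * Real.exp (-(δ' * R₀)) * Real.exp (-((δ - δ') * g.dist y y')))) := by
  have hS := hasMaj_mulOp_sandwich blk (fun _ _ => mul_nonneg hc (Real.exp_nonneg _)) hh hk hT
  have hout' : ∀ μ x, blk x ∉ H → (mulOp h ∘ₗ T ∘ₗ mulOp k) μ x = 0 := fun μ x hx => by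
    have h0 : h x = 0 := by by_contra hne; exact hx (hH x hne)
    simp only [LinearMap.comp_apply, mulOp_apply, h0, zero_mul]
  have hin' : ∀ μ : X → ℝ, (∀ x, blk x ∈ K → μ x = 0) → (mulOp h ∘ₗ T ∘ₗ mulOp k) μ = 0 := fun μ hμ => by
    have h0 : mulOp k μ = 0 := funext fun x => by
      by_cases hkx : k x = 0
      · simp [mulOp_apply, hkx]
      · simp [mulOp_apply, hμ x (hKs x hkx)]
    rw [LinearMap.comp_apply, LinearMap.comp_apply, h0, map_zero, map_zero]
  refine (hasMaj_localize₂ blk blk (fun _ _ => mul_nonneg hc (Real.exp_nonneg _)) hout' hin' hS).mono fun y y' => ?_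
  by_cases hy : y ∈ H
  · by_cases hy' : y' ∈ K
    · simp only [ind_of_mem hy, ind_of_mem hy', one_mul]
      rw [mul_assoc, ← Real.exp_add]
      refine mul_le_mul_of_nonneg_left (Real.exp_le_exp.mpr ?_) hc
      have hd := hsep y hy y' hy'
      nlinarith
    · have : ind K y' = 0 := by unfold ind; rw [if_neg hy']
      rw [this]; simp
  · have : ind H y = 0 := by unfold ind; rw [if_neg hy]
    rw [this]; simp

end Separated

/-! ## §4 The defect's majorant; dressing the sandwiched cube at a live background -/

section Defect

variable {X ι J : Type} [Fintype X] [DecidableEq X] [Fintype ι] [DecidableEq ι] [Fintype J] [DecidableEq J] (τ : J → X ≃ X) (n : ℝ)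
  {G : (X × ι → ℝ) →ₗ[ℝ] (X × ι → ℝ)} {D : J ⊕ J → (X × ι → ℝ) →ₗ[ℝ] (X × ι → ℝ)} (C : X → Matrix ι ι ℝ) (A : J ⊕ J → X → Matrix ι ι ℝ)
  {g : B6.Geometry} (blk : X → g.Site) {σ cr : ℝ}

omit [DecidableEq X] [DecidableEq ι] in
/-- ★★ **THE SANDWICH DEFECT IS EXPONENTIALLY SMALL IN THE COLLAR**: `N ≤ c_Ne^{−δ_Nd}`, `G ≤ βe^{−δd}`, `|h| ≤ 1` over `H`, `|1 − χ| ≤ 1` over `K`, `d(H, K) ≥ R₀`, `0 ≤ δ′`,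
`ρ + σ ≤ δ_N − δ′`, `ρ ≤ δ` ⟹ `E = −(M_hNM_{1−χ})∘G ≤ 1_H(y)·c_Ne^{−δ′R₀}βc_r·e^{−ρd}`. [cite: Balaban1984PropagatorsI, (1.126)–(1.128) p.38 (mechanism); Balaban1984PropagatorsII, (2.52)–(2.56), (2.61)] -/
theorem hasMaj_sandwichDefect (htri : Triangle254 g) (hd : ∀ a b : g.Site, 0 ≤ g.dist a b) (hrow : RowSum g σ cr) (hcr : 0 ≤ cr) {N : (X × ι → ℝ) →ₗ[ℝ] (X × ι → ℝ)} {h χ : X × ι → ℝ}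
    {H K : Set g.Site} {cN δN δ δ' R₀ β ρ : ℝ} (hcN : 0 ≤ cN) (hβ : 0 ≤ β) (hδ' : 0 ≤ δ') (hρ : 0 ≤ ρ) (hρδ : ρ ≤ δ) (hρN : ρ + σ ≤ δN - δ') (hh : ∀ p, |h p| ≤ 1)
    (hk : ∀ p, |(1 - χ) p| ≤ 1) (hH : ∀ p, h p ≠ 0 → liftBlk blk ι p ∈ H) (hKs : ∀ p, (1 - χ) p ≠ 0 → liftBlk blk ι p ∈ K) (hsep : ∀ y ∈ H, ∀ y' ∈ K, R₀ ≤ g.dist y y')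
    (hN : HasMaj (BlockNorm.ofBlocks g (liftBlk blk ι)) (BlockNorm.ofBlocks g (liftBlk blk ι)) N (fun y y' => cN * Real.exp (-(δN * g.dist y y'))))
    (hG : HasMaj (BlockNorm.ofBlocks g (liftBlk blk ι)) (BlockNorm.ofBlocks g (liftBlk blk ι)) G (fun y y' => β * Real.exp (-(δ * g.dist y y')))) :
    HasMaj (BlockNorm.ofBlocks g (liftBlk blk ι)) (BlockNorm.ofBlocks g (liftBlk blk ι)) ((-(mulOp h ∘ₗ N ∘ₗ mulOp (1 - χ))) ∘ₗ G)
      (fun y y' => ind H y * (cN * Real.exp (-(δ' * R₀)) * β * cr * Real.exp (-(ρ * g.dist y y')))) := by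
  have hS := hasMaj_sandwich_separated (liftBlk blk ι) hcN hδ' hh hk hH hKs hsep hN
  have hS' : HasMaj (BlockNorm.ofBlocks g (liftBlk blk ι)) (BlockNorm.ofBlocks g (liftBlk blk ι)) (-(mulOp h ∘ₗ N ∘ₗ mulOp (1 - χ)))
      (fun y y' => cN * Real.exp (-(δ' * R₀)) * Real.exp (-((δN - δ') * g.dist y y'))) := by
    refine hS.neg.mono fun y y' => ?_
    have h1 : ind H y * ind K y' ≤ 1 := by
      unfold ind; split_ifs <;> norm_num
    have h0 : 0 ≤ cN * Real.exp (-(δ' * R₀)) * Real.exp (-((δN - δ') * g.dist y y')) := by positivity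
    calc ind H y * ind K y' * (cN * Real.exp (-(δ' * R₀)) * Real.exp (-((δN - δ') * g.dist y y')))
        ≤ 1 * (cN * Real.exp (-(δ' * R₀)) * Real.exp (-((δN - δ') * g.dist y y'))) :=
          mul_le_mul_of_nonneg_right h1 h0
      _ = _ := one_mul _
  have hcomp := hasMaj_comp_exp htri hd hrow (by positivity : 0 ≤ cN * Real.exp (-(δ' * R₀))) hβ hρ hρδ hρN hS' hG
  have hout : ∀ μ p, blk p.1 ∉ H → ((-(mulOp h ∘ₗ N ∘ₗ mulOp (1 - χ))) ∘ₗ G) μ p = 0 := fun μ p hp => by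
    have h0 : h p = 0 := by by_contra hne; exact hp (hH p hne)
    simp only [LinearMap.comp_apply, LinearMap.neg_apply, Pi.neg_apply, mulOp_apply, h0, zero_mul, neg_zero]
  refine (hasMaj_localize_out blk (fun _ _ => ?_) hout hcomp).mono fun y y' => le_of_eq ?_
  · exact mul_nonneg (by rw [kappa_ofBlocks]; positivity) (Real.exp_nonneg _)
  · rw [kappa_ofBlocks]; ring

/-- ★★★ **THE SANDWICHED FLAT CUBE, DRESSED AT A LIVE BACKGROUND, INVERTS `Δ − V(c, a)` AGAINST `h` MODULO THE DRESSED TAIL**: with `G₀ = M_χ∘G`, the unsandwiched `hloc`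
`M_h∘Δ∘G = M_h`, the split `Δ = L + N` and the local part's separation `M_hLM_{1−χ} = 0`:
`M_h∘(Δ − V(c,a))∘pr₀X̂ = M_h + E∘(1 + V∘pr₀X̂)`, `E = −(M_hNM_{1−χ})∘G` (file 21 `mulOp_comp_sub_speciesOpM_comp_dressed_of_defect`; `E`'s letter: `hasMaj_sandwichDefect`, the dressed tail's:
file 21 `hasMaj_defect_comp`). [cite: Balaban1984PropagatorsII, (2.37)–(2.38) p.229, (2.91) p.239 (mechanism); Balaban1985BackgroundPropagators, (3.62)–(3.65) pp.402–403] -/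
theorem mulOp_comp_sub_speciesOpM_comp_dressed_sandwich {Δ L N : (X × ι → ℝ) →ₗ[ℝ] (X × ι → ℝ)} {h χ : X × ι → ℝ} (hloc0 : mulOp h ∘ₗ Δ ∘ₗ G = mulOp h) (hΔ : Δ = L + N)
    (hL : mulOp h ∘ₗ L ∘ₗ mulOp (1 - χ) = 0) (hDf : ∀ μ, D (Sum.inl μ) = fgrad n (liftEquiv (τ μ) ι) ∘ₗ (mulOp χ ∘ₗ G))
    (hDb : ∀ μ, D (Sum.inr μ) = bgrad n (liftEquiv (τ μ) ι) ∘ₗ (mulOp χ ∘ₗ G)) (hunit : IsUnit (1 - LinearMap.toMatrix' (stack (mulOp χ ∘ₗ G) D ∘ₗ unstackM C A))) :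
    mulOp h ∘ₗ (Δ - speciesOpM τ n C A) ∘ₗ (projO none ∘ₗ bgPairM (mulOp χ ∘ₗ G) D C A) =
      mulOp h + ((-(mulOp h ∘ₗ N ∘ₗ mulOp (1 - χ))) ∘ₗ G) ∘ₗ (LinearMap.id + speciesOpM τ n C A ∘ₗ (projO none ∘ₗ bgPairM (mulOp χ ∘ₗ G) D C A)) :=
  mulOp_comp_sub_speciesOpM_comp_dressed_of_defect τ n C A Δ _ h (mulOp_comp_comp_sandwich_of_hloc hloc0 hΔ hL) hDf hDb hunit

end Defect

end Summit.QuantumFields.YangMills.BalabanUVNodes.N15.CurvedSpecies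

end
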